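import Summits.CriticalPhenomena.PercolationContinuityZ3.Theorems.Transplant.CayleyZ2RotC4SideSteps
import Summits.CriticalPhenomena.PercolationContinuityZ3.Theorems.Transplant.AutChartOrbitsCriticalContinuity
import HarnessLib

/-!
# REGRESSION INSTANCE (r1) of the (N3) orbit theorem: `X′ = Cay(ℤ² ⋊ C₄; ρ, x, ρxρ⁻¹)` through `AutChart.criticalContinuity_of_autSubgroup_finite_orbits`

builds on p205010 (kernel theorem, internal audit signed; external expert review pending).  Lane `prim-bschramm`, seat `prim-bschramm-stmt` gen 31
(port pen; row (r1) handed by the design owner p3 g28, bus 2026-08-27T03:46Z).  Helper file (`--supports stmt-CriticalPhenomena-4575 --as helper`);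
PROOFS ONLY over p5 g27's «CayleyZ2RotC4SideSteps» (the explicit graph `Z2RotSide.graph` on `ℤ² × Fin 4`, its translations `shiftIso`, single-edge unit
steps `exists_step`, `abs_sub_le`, box reachability `reachable_zero`) and p3 g28's (N3) orbit theorem «AutChartOrbitsCriticalContinuity» (p493117).
No `@[conjecture]` is declared, edited or claimed; no new definition.

WHAT IS CHECKED.  p5 g27 proved `Z2RotSide.criticalContinuity : ∀ v, θ_v(p_c(X′)) = 0` through the hand-built four-type chart-aligned skeleton
`Z2RotSide.skel` and the aligned multi-type node (p491075 over p486426).  Here the SAME conclusion is obtained through the (N3) interface instead, with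
the data the design owner prescribed: `A :=` the translation subgroup `⟨shiftIso u : u ∈ ℤ²⟩ ≤ Aut(X′)` (FOUR orbits = the four headings; every element is
a translation of the position, `exists_shift_of_mem_closure`), transversal `reps := Z2Rot.types = {((0,0), k)}`, chart `φ := Prod.fst` (translated by `A`,
constant `0` on the transversal), scale `N := 1` (`abs_sub_le`: unit range along every bond; `exists_step`: the four exact unit steps along single edges at
every base vertex), and `X′` connected (`reachable_origin`, from p5's box reachability).  Conclusions: `orbit_criticalContinuity` (θ_v(p_c) = 0 at every vertex, via
`AutChart.criticalContinuity_of_autSubgroup_finite_orbits`) and `orbit_conj4` (`p_c(X′) < 1 ∧ θ_v(p_c) = 0`, via `AutChart.conj4_of_finite_orbits` with the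
chart character `AutChart.chartHom`) — the first conjunct is NEW for `X′` (p5's file has `θ = 0` and the drop).  So the (N3) hypotheses are inhabited by a
genuinely multi-orbit example (b₁(ℤ² ⋊ C₄) = 0: no one-type node applies) and reproduce p5's theorem.
[cite: BenjaminiSchramm1996, Conj. 4; §2 (almost transitive / quasi-transitive graphs)] [cite: KozmaNitzan2024, §1 p. 2 (approach 1)]
-/

namespace Summit.CriticalPhenomena.PercolationContinuityZ3.Theorems.Transplant

open SimpleGraph Literature.Probability.Percolation Literature.Probability.LatticeModels
open scoped Classical

namespace Z2RotSide

open Z2Rot (dir Vtx types mem_types)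

/-! ## §1 `X′` is connected -/

/-- **Every vertex of `X′` is joined to `((0,0), 0)`**: it lies in a box cylinder, inside which p5 g27's `reachable_zero` joins it to the origin.
[folklore] -/
theorem reachable_origin (a : Vtx) : graph.Reachable a ((0 : Site 2), (0 : Fin 4)) := by
  obtain ⟨v, k⟩ := a
  set ℓ : ℕ := (v 0).natAbs + (v 1).natAbs with hℓ
  have ha : ((v, k) : Vtx) ∈ boxSet ℓ := by rw [mem_boxSet₂]; omega
  exact (reachable_zero _ ha).map (Embedding.induce _).toHom

/-- **`X′` is connected.** [folklore] -/
theorem graph_connected_sideSteps : graph.Preconnected ∧ Nonempty Vtx :=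
  ⟨fun a b => (reachable_origin a).trans (reachable_origin b).symm, ⟨((0 : Site 2), (0 : Fin 4))⟩⟩

/-! ## §2 The translation subgroup `⟨shiftIso u : u ∈ ℤ²⟩ ≤ Aut(X′)` and its transversal `Z2Rot.types` -/

/-- **Every element of the translation subgroup is a translation of the position** `(w, m) ↦ (w + u, m)` (closure induction: generators, identity,
products and inverses of translations are translations). [folklore] -/
theorem exists_shift_of_mem_closure {α : graph ≃g graph} (hα : α ∈ Subgroup.closure (Set.range shiftIso)) :
    ∃ u : Site 2, ∀ w : Vtx, α w = (w.1 + u, w.2) := by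
  induction hα using Subgroup.closure_induction with
  | mem x hx =>
    obtain ⟨u, rfl⟩ := hx
    exact ⟨u, fun w => rfl⟩
  | one => exact ⟨0, fun w => by rw [RelIso.one_apply, add_zero]⟩
  | mul x y _ _ ihx ihy =>
    obtain ⟨u, hu⟩ := ihx
    obtain ⟨u', hu'⟩ := ihy
    exact ⟨u' + u, fun w => by rw [RelIso.mul_apply, hu', hu, add_assoc]⟩
  | inv x _ ih =>
    obtain ⟨u, hu⟩ := ih
    refine ⟨-u, fun w => ?_⟩
    have h : ((x⁻¹ w).1 + u, (x⁻¹ w).2) = w := by rw [← hu, RelIso.apply_inv_self]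
    obtain ⟨h1, h2⟩ := Prod.ext_iff.1 h
    refine Prod.ext ?_ h2
    show (x⁻¹ w).1 = w.1 + -u
    rw [← sub_eq_add_neg, eq_sub_iff_add_eq]
    exact h1

/-- The position vanishes on the four base vertices `((0,0), k)`. [folklore] -/
theorem fst_eq_zero_of_mem_types {r : Vtx} (hr : r ∈ types) : r.1 = 0 := by
  simp only [Z2Rot.types, Finset.mem_insert, Finset.mem_singleton] at hr
  rcases hr with rfl | rfl | rfl | rfl <;> rfl

/-- **`Z2Rot.types` is a TRANSVERSAL of the translation subgroup**: a translation carrying one base vertex to another fixes the heading, hence is the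
identity on it. [folklore] -/
theorem types_transversal : ∀ r ∈ types, ∀ r' ∈ types, ∀ α ∈ Subgroup.closure (Set.range shiftIso), α r = r' → r = r' := by
  intro r hr r' hr' α hα h
  obtain ⟨u, hu⟩ := exists_shift_of_mem_closure hα
  rw [hu] at h
  obtain ⟨-, h2⟩ := Prod.ext_iff.1 h
  exact Prod.ext (by rw [fst_eq_zero_of_mem_types hr, fst_eq_zero_of_mem_types hr']) h2

/-- **… and every vertex is a translate of a base vertex** (`(w, m) = shiftIso w ((0,0), m)`): FOUR orbits. [folklore] -/
theorem types_cover : ∀ w : Vtx, ∃ α ∈ Subgroup.closure (Set.range shiftIso), ∃ r ∈ types, α r = w := fun w =>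
  ⟨shiftIso w.1, Subgroup.subset_closure ⟨w.1, rfl⟩, ((0 : Site 2), w.2), mem_types w.2, by
    show ((0 : Site 2) + w.1, w.2) = w
    rw [zero_add]⟩

/-- **The chart `Prod.fst` is TRANSLATED by the translation subgroup**: `(α w).1 = w.1 + ((α t).1 − t.1)` at the base vertex `t = ((0,0), 0)`. [folklore] -/
theorem fst_translated : ∀ α ∈ Subgroup.closure (Set.range shiftIso), ∀ w : Vtx,
    (α w).1 = w.1 + ((α ((0 : Site 2), (0 : Fin 4))).1 - (((0 : Site 2), (0 : Fin 4)) : Vtx).1) := by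
  intro α hα w
  obtain ⟨u, hu⟩ := exists_shift_of_mem_closure hα
  rw [hu, hu]
  simp

/-- The chart takes one common value (`0`) on the transversal. [folklore] -/
theorem fst_const_types : ∀ r ∈ types, ∀ r' ∈ types, r.1 = r'.1 := fun _ hr _ hr' => by
  rw [fst_eq_zero_of_mem_types hr, fst_eq_zero_of_mem_types hr']

/-! ## §3 Scale `N = 1`: unit range along the bonds at the base vertices, and the four exact unit steps along single edges -/

/-- Along a bond at a base vertex the position changes by at most `N = 1` in each coordinate (p5 g27's `abs_sub_le`). [folklore] -/
theorem lip_types : ∀ r ∈ types, ∀ w : Vtx, graph.Adj r w → ∀ i : Fin 2, |w.1 i - r.1 i| ≤ ((1 : ℕ) : ℤ) :=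
  fun _ _ _ h i => by
    rw [abs_sub_comm, Nat.cast_one]
    exact abs_sub_le h i

/-- At every base vertex, each of the four displacements `± N eᵢ` (`N = 1`) is realised along a SINGLE edge (p5 g27's `exists_step`: the move or the
side-step). [folklore] -/
theorem step_types : ∀ r ∈ types, ∀ (i : Fin 2) (σ : ℤˣ), ∃ w : Vtx, graph.Adj r w ∧ w.1 = r.1 + Pi.single i (((1 : ℕ) : ℤ) * σ) := by
  rintro ⟨v, k⟩ - i σ
  obtain ⟨b, hb, hφ⟩ := exists_step v k i σ
  exact ⟨b, hb, by rw [hφ, Nat.cast_one, one_mul]⟩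

/-! ## §4 The regression: `θ_v(p_c(X′)) = 0` and `p_c(X′) < 1` through the (N3) orbit theorem -/

/-- **REGRESSION INSTANCE (r1).  `θ_v(p_c) = 0` at every vertex of `X′ = Cay(ℤ² ⋊ C₄; ρ, x, ρxρ⁻¹)` THROUGH THE (N3) ORBIT THEOREM**
`AutChart.criticalContinuity_of_autSubgroup_finite_orbits` (p3 g28, p493117) — data: the translation subgroup of `Aut(X′)` (four orbits), transversal
`Z2Rot.types`, chart `Prod.fst`, scale `N = 1`.  Same statement as p5 g27's `Z2RotSide.criticalContinuity` (there: the hand-built aligned four-type skeleton).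
builds on p205010 (kernel theorem, internal audit signed; external expert review pending). [cite: BenjaminiSchramm1996, Conj. 4; §2]
[cite: KozmaNitzan2024, §1 p. 2 (approach 1)] -/
theorem orbit_criticalContinuity (v : Vtx) : theta graph v (criticalProbIOf graph v) = 0 :=
  AutChart.criticalContinuity_of_autSubgroup_finite_orbits ((connected_iff _).2 graph_connected_sideSteps) (Subgroup.closure (Set.range shiftIso))
    types types_transversal types_cover Prod.fst (t := ((0 : Site 2), (0 : Fin 4))) fst_translated fst_const_types 1 le_rfl lip_types step_types v

/-- **… and Conj. 4 in its own shape on `X′`: `p_c(X′) < 1 ∧ θ_v(p_c) = 0` at every vertex**, through `AutChart.conj4_of_finite_orbits` fed with the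
chart character `AutChart.chartHom` of `Prod.fst` on the translation subgroup (the first conjunct — `p_c < 1` from the rank-two pair of unit step movers,
p4 g25's `criticalProb_lt_one_of_finite_orbits` — is not in p5 g27's file).  builds on p205010 (kernel theorem, internal audit signed; external expert
review pending). [cite: BenjaminiSchramm1996, Conj. 4; §2 Conj. 1] [cite: LyonsPeres2016, §7.4 Thm. 7.15] -/
theorem orbit_conj4 (v : Vtx) : criticalProb graph v < 1 ∧ theta graph v (criticalProbIOf graph v) = 0 := by
  letI : MulAction (graph ≃g graph) Vtx := AutChart.autMulAction graph
  have hact : IsActionByAut graph (Subgroup.closure (Set.range shiftIso)) := fun a x y => (a : graph ≃g graph).map_rel_iff'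
  have hφ : ∀ (a : Subgroup.closure (Set.range shiftIso)) (w : Vtx),
      (a • w).1 = w.1 + ((a • (((0 : Site 2), (0 : Fin 4)) : Vtx)).1 - (((0 : Site 2), (0 : Fin 4)) : Vtx).1) :=
    fun a w => fst_translated a a.2 w
  -- the value of the chart character at `a` is the translation vector of `a`
  have hval : ∀ (a : Subgroup.closure (Set.range shiftIso)) (u : Site 2), (∀ w : Vtx, (a : graph ≃g graph) w = (w.1 + u, w.2)) →
      Multiplicative.toAdd (AutChart.chartHom _ Prod.fst hφ a) = u := fun a u hu => by
    rw [AutChart.toAdd_chartHom]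
    show ((a : graph ≃g graph) ((0 : Site 2), (0 : Fin 4))).1 - (0 : Site 2) = u
    rw [hu, sub_zero]
    exact zero_add u
  refine AutChart.conj4_of_finite_orbits hact ((connected_iff _).2 graph_connected_sideSteps) types (fun r hr r' hr' a ha => types_transversal r hr r' hr' a a.2 ha)
    (fun w => by obtain ⟨α, hα, r, hr, hw⟩ := types_cover w; exact ⟨⟨α, hα⟩, r, hr, hw⟩) (AutChart.chartHom _ Prod.fst hφ)
    (t := ((0 : Site 2), (0 : Fin 4))) (fun h hh => ?_) 1 le_rfl (fun r hr r' hr' a ha i => ?_) (fun r hr i σ => ?_) v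
  · show Multiplicative.ofAdd ((h • (((0 : Site 2), (0 : Fin 4)) : Vtx)).1 - (((0 : Site 2), (0 : Fin 4)) : Vtx).1) = 1
    rw [MulAction.mem_stabilizer_iff.1 hh, sub_self, ofAdd_zero]
  · obtain ⟨u, hu⟩ := exists_shift_of_mem_closure a.2
    rw [hval a u hu, Nat.cast_one]
    have hadj : graph.Adj r ((a : graph ≃g graph) r') := ha
    have := abs_sub_le hadj i
    rw [hu, fst_eq_zero_of_mem_types hr, fst_eq_zero_of_mem_types hr'] at this
    simpa using this
  · obtain ⟨w, hw, hφw⟩ := step_types r hr i σ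
    refine ⟨⟨shiftIso w.1, Subgroup.subset_closure ⟨w.1, rfl⟩⟩, ((0 : Site 2), w.2), mem_types w.2, ?_, ?_⟩
    · show graph.Adj r (shiftIso w.1 ((0 : Site 2), w.2))
      have e : shiftIso w.1 ((0 : Site 2), w.2) = w := by
        show ((0 : Site 2) + w.1, w.2) = w
        rw [zero_add]
      rw [e]
      exact hw
    · rw [hval _ w.1 (fun w' => rfl), hφw, fst_eq_zero_of_mem_types hr, zero_add]

/-! ## §5 (append 2026-08-27T04:20Z, stmt-g31) The same through the design owner's §6 front-end `AutChart.conj4_of_autSubgroup_finite_orbits` -/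

/-- **REGRESSION of the §6 front-end (p3 g28's append to «AutChartOrbitsCriticalContinuity», 2026-08-27): `p_c < 1 ∧ θ_v(p_c) = 0` at every vertex of
`Z2RotSide.graph` (= `ℤ² □ C₄`, see the ERRATUM below) by ONE application of `AutChart.conj4_of_autSubgroup_finite_orbits`** to the translation subgroup
(four orbits), the transversal `Z2Rot.types`, the chart `Prod.fst` and `N = 1` — the same argument list as `orbit_criticalContinuity`; agrees with the
hand-threaded `orbit_conj4` above.  builds on p205010 (kernel theorem, internal audit signed; external expert review pending).
[cite: BenjaminiSchramm1996, Conj. 4; §2 Conj. 1] -/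
theorem orbit_conj4_frontEnd (v : Vtx) : criticalProb graph v < 1 ∧ theta graph v (criticalProbIOf graph v) = 0 :=
  AutChart.conj4_of_autSubgroup_finite_orbits ((connected_iff _).2 graph_connected_sideSteps) (Subgroup.closure (Set.range shiftIso))
    types types_transversal types_cover Prod.fst (t := ((0 : Site 2), (0 : Fin 4))) fst_translated fst_const_types 1 le_rfl lip_types step_types v

end Z2RotSide

end Summit.CriticalPhenomena.PercolationContinuityZ3.Theorems.Transplant

/-! ## ERRATUM to the header (stmt-g31, 2026-08-27T04:05Z; refuter p5 g27's located item (E1), lane bus 2026-08-27T04:00Z)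

The clause «a genuinely multi-orbit example (b₁(ℤ² ⋊ C₄) = 0: no one-type node applies)» in the header above is WRONG AS WORDS and is withdrawn:
`Z2RotSide.graph` is, identically, the product graph `ℤ² □ C₄` (at every heading the move / side-step displacements are `{±e₀, ±e₁}`, the turns are the
`C₄` factor), so it is also `Cay(ℤ² × ℤ/4; ±e₀, ±e₁, ±1)`; the heading shift `(v, k) ↦ (v, k+1)` is a chart-PRESERVING automorphism, `ℤ² × C₄` translates
the chart transitively, and the four-type skeleton is one-type-able — `θ(p_c) = 0` for this graph was already in the tree through the product node.  What
the theorems of this file establish is unchanged and exactly this: the (N3) orbit theorem's hypotheses (`criticalContinuity_of_autSubgroup_finite_orbits`,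
`conj4_of_finite_orbits`) are met by the translation subgroup with its FOUR orbits on `Z2RotSide.graph` and reproduce `θ_v(p_c) = 0` (and give
`p_c < 1`) by a second kernel route — a REGRESSION instance of the interface, not a new reach and not a vacuity witness for 'outside every one-type node'
(that role passes to the non-vertex-transitive ℤ²-periodic bilayer (c4) of p3 g28's NEXT-SCOPE §20.2).  No declaration is changed by this erratum. -/
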